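import Summits.BirchSwinnertonDyer.Rank1Residual.P2.KrizLiJZeroBasesMembership
import Summits.BirchSwinnertonDyer.Rank1Residual.P2.KrizLiTwoFortyThreeFields
import Summits.BirchSwinnertonDyer.Rank1Residual.P2.KrizLiCubeSumThirteenMembership
import Literature.NumberTheory.EllipticCurves.HeegnerFieldOfDiscriminantProofs
import HarnessLib

/-!
# Cell `bsd-print-cf2` (D-0131 (2) PRINT TIER, leaf CornerF @ `p = 2`), seat ty2 — the Heegner field of a
# (★)-certificate BY NAME: Kriz–Li membership and `BSD(W′, 2)` over `K = ℚ(√D)` for an ARBITRARY certified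
# discriminant `D` (composite included) — the five (★)-bases GOOD at `2` (`1323a1`, `1323m1`, `4563a1`, `243a1`, `4563b1`)

HONEST FRAMING (cell `bsd-print-cf2`, run/shared/lean/pub/bsd-print-cf2/; verbatim): PARTITION currency
only — the leaf counts when its class theorem is in the kernel BY NAME; every imported theorem carries its
printed hypotheses verbatim. The leaf is OPEN AS A CLASS; nothing class-wide is closed here; theorems only,
no definition, no named fact.

What this adds. The Kriz–Li door (aside 21366 `InertKrizLiStarDoorOfFactsPlus`, p3's generic
`bsdp_two_of_isIsogenousToKrizLiTwistOfSmallCMBase`) is reached, base by base, through the membership theorems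
`isIsogenousToKrizLiTwistOfSmallCMBase_of_curveX` (ty2 g3; p3 for `243a1`, `4563b1`), which are GENERIC in the
Heegner field `K` with binders `hK : IsImaginaryQuadratic K`, `jacobiSym (d_K) q = 1`, `d_K ≡ 1 (mod 8)`. The
(★)-certificates of the cell (lit g5, 118 TRUE pairs `(E, ℚ(√D))`, `|D| ≤ 800`; ty3's records
`CornerFTwoCertificates.RecordsStarJZeroGood/Bad`, whose kernel recheck yields per record
`D < 0 ∧ D % 8 = 1 ∧ Squarefree D.natAbs ∧ (D/ℓ) = 1` at the odd `ℓ ∣ N`) name the field by `D` alone, and 55 of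
the 118 certified pairs (15 of the 31 distinct fields) have COMPOSITE `D` (`−95, −119, −143, −215, −287, −335,
−407, −455, −527, −551, −623, −671, −695, −767, −791`), where the tree so far had `IsImaginaryQuadratic (sqrtField D) ∧ d_K = D` only for
prime `|D|` (`−23`, `−47`). With `Literature…HeegnerFieldOfDiscriminantProofs` (`d_K(ℚ(√D)) = D` for `D < 0`,
`D ≡ 1 (mod 4)` squarefree — Marcus Ch. 2 Thm. 1) this file states, for each of the five (★)-bases `X` GOOD at `2` (the four ADDITIVE
ones are in the companion `KrizLiStarFieldsAdditiveBases.lean`) and EVERY such `D`: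

* `inN_curveX_of_discr_eq` — `d ∈ 𝒩(X, K)` in any quadratic `K` with `d_K = D`, from decidable data on the
  prime factors of `d` phrased with the NUMERAL `D` (`(D/ℓ) = 1`, cube-root count in `𝔽_ℓ`);
* `isIsogenousToKrizLiTwistOfSmallCMBase_of_curveX_sqrtField` — membership of every `W′` `ℚ`-isogenous to
  `X^{(d)}` or `X^{(D·d)}` over `K = sqrtField D`, from `D % 4 = 1` (or `D % 8 = 1` at the additive bases),
  `Squarefree D.natAbs`, the Heegner symbols `(D/3) = (D/q) = 1`, the DISPLAYED `hSD : HasKrizLiStarDatum X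
  (sqrtField D)`, and `d ∈ 𝒩`, `d > 0`, `d ≡ 1 (mod 12)` (`q ∤ d`);
* `bsdp_two_of_isIsogenous_twist_curveX_sqrtField` — hence `BSD(W′, 2)` for every globally minimal such `W′`,
  granted BY NAME the seven facts `hKL h33 hS31 hBF hmod hGZK hCassels` of aside 21366.

* §3 (E-GENERIC, appended): `analyticRank_eq_one_of_hasKrizLiStarDatum_sqrtField`,
  `isIsogenousToKrizLiTwistOfSmallCMBase_of_hasKrizLiStarDatum_sqrtField`,
  `bsdp_two_of_isIsogenous_twist_of_hasKrizLiStarDatum_sqrtField` — the same for ANY (★)-base `W` (CM, `N < 5000`,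
  rank ≥ 1, `E(ℚ)[2] = 0`, `c₂` odd) with the Heegner hypothesis read off `(D/ℓ) = 1` at the odd `ℓ ∣ N(W)`: the
  one-call entry point for further certified bases.

So a certified star record `(X, D)` together with a certified member `d` is ONE application away from
`BSD(W′, 2)` by name, whatever `D` is. Currency: LITERAL-by-name((★)-certificate displayed as `hSD`); for
`(243a1, −23)` the datum is PRINTED (Table 1). beyond-print theorem: NO.
[cite: KrizLi2019, Thm. 1.12 (FMS Thm. 5.1 (2)), Def. 4.1, §6 Ex. 6.2, Rem. 6.3 and Table 1]

References: [KrizLi2019] Thm 1.12/5.1, Def 4.1, §6; [Marcus2018] Ch. 2 Thm. 1, Ch. 3 Thm. 25;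
[CreutzMiller2012] Thm 1.1; [BurungaleFlach2024] Cor 2; [MilneADT2006] Thm I.7.3; HOME/lit/census-g5/STARCERT-TABLE.md.
-/

noncomputable section

open scoped Classical

open WeierstrassCurve NumberField Literature.NumberTheory.EllipticCurves
  Literature.NumberTheory.EllipticCurves.Rank1Residual
  Literature.NumberTheory.EllipticCurves.ModularForms
  Summit.BirchSwinnertonDyer.Rank1Residual

set_option autoImplicit false

namespace Summit.BirchSwinnertonDyer.Rank1Residual.P2

/-! ## §1 The three (★)-bases GOOD at `2`: `1323a1`, `1323m1` (`q = 7`), `4563a1` (`q = 13`) -/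

/-- `d ∈ 𝒩(1323a1, K)` in any quadratic `K` with `d_K = D`, from explicit data phrased with `D`.
[cite: KrizLi2019, Def. 4.1 (FMS) = arXiv Def. 3.1] -/
theorem inN_curve1323a1_of_discr_eq {K : Type} [Field K] [NumberField K] (h2 : Module.finrank ℚ K = 2)
    {D : ℤ} (hdK : NumberField.discr K = D) {d : ℤ} (hd4 : d % 4 = 1) (hsq : Squarefree d.natAbs)
    (hprimes : ∀ (ℓ : ℕ) (hℓ : ℓ.Prime), ℓ ∣ d.natAbs → haveI : NeZero ℓ := ⟨hℓ.ne_zero⟩;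
      ℓ ≠ 2 ∧ ℓ ≠ 3 ∧ ℓ ≠ 7 ∧ jacobiSym D ℓ = 1 ∧
      Even ((Finset.univ.filter fun x : ZMod ℓ => x ^ 3 = -(16 * (4 * (600 : ZMod ℓ) + 1))).card)) :
    KrizLi2019.InN curve1323a1 K d := by
  subst hdK
  exact inN_curve1323a1_of_explicit h2 hd4 hsq hprimes

/-- **`1323a1` over `K = ℚ(√D)`, ANY certified `D`**: `D < 0`, `D ≡ 1 (mod 4)`, `|D|` square-free,
`(D/3) = (D/7) = 1`, (★) displayed; `d ∈ 𝒩`, `d > 0`, `d ≡ 1 (mod 12)`, `7 ∤ d` ⟹ every `W′ ~ E^{(d)}` or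
`E^{(D·d)}` is a member of the generic Kriz–Li family. [cite: KrizLi2019, Thm. 5.1 (2), Def. 4.1, §6 Ex. 6.2]
[cite: Marcus2018, Ch. 2 Thm. 1] -/
theorem isIsogenousToKrizLiTwistOfSmallCMBase_of_curve1323a1_sqrtField {D : ℤ} [Fact (D < 0)]
    (hD4 : D % 4 = 1) (hsf : Squarefree D.natAbs) (h3 : jacobiSym D 3 = 1) (h7 : jacobiSym D 7 = 1)
    (hSD : HasKrizLiStarDatum curve1323a1 (sqrtField D)) {d : ℤ}
    (hd : KrizLi2019.InN curve1323a1 (sqrtField D) d) (hd0 : 0 < d) (hd12 : d % 12 = 1) (h7d : ¬ (7 : ℤ) ∣ d)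
    {W' : WeierstrassCurve ℚ}
    (hiso : IsIsogenous W' (curve1323a1.quadraticTwist (d : ℚ)) ∨
      IsIsogenous W' (curve1323a1.quadraticTwist ((D * d : ℤ) : ℚ))) :
    IsIsogenousToKrizLiTwistOfSmallCMBase W' := by
  obtain ⟨hK, hdK⟩ := isImaginaryQuadratic_and_discr_sqrtField_of_squarefree_natAbs D hD4 hsf
  refine isIsogenousToKrizLiTwistOfSmallCMBase_of_curve1323a1 hK (by rw [hdK]; exact h3)
    (by rw [hdK]; exact h7) hSD hd hd0 hd12 h7d ?_
  rw [hdK, mul_comm]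
  exact hiso

/-- **`BSD(W′, 2)` on the Kriz–Li family of `1323a1` over `ℚ(√D)`, any certified `D`**, granted BY NAME the seven
facts of aside 21366 and the displayed (★)-datum. [cite: KrizLi2019, Thm. 5.1 (2) and Thm. 4.3]
[cite: CreutzMiller2012, Thm. 1.1] [cite: BurungaleFlach2024, Thm. 1.1 and Cor. 2] [cite: MilneADT2006, Thm. I.7.3] -/
theorem bsdp_two_of_isIsogenous_twist_curve1323a1_sqrtField (hKL : KrizLi2019.thm112_bsdTwo_twist)
    (h33 : KrizLi2019.thm33_rank_twist) (hS31 : bsdTriple_of_analyticRank_le_one_of_conductor_lt)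
    (hBF : bsdTriple_of_hasCM_of_L_one_ne_zero) (hmod : hasEntireLFunction_rat)
    (hGZK : rank_eq_analyticRank_of_analyticRank_le_one) (hCassels : bsdRHS_eq_of_isIsogenous)
    {D : ℤ} [Fact (D < 0)] (hD4 : D % 4 = 1) (hsf : Squarefree D.natAbs) (h3 : jacobiSym D 3 = 1)
    (h7 : jacobiSym D 7 = 1) (hSD : HasKrizLiStarDatum curve1323a1 (sqrtField D)) {d : ℤ}
    (hd : KrizLi2019.InN curve1323a1 (sqrtField D) d) (hd0 : 0 < d) (hd12 : d % 12 = 1) (h7d : ¬ (7 : ℤ) ∣ d)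
    (W' : WeierstrassCurve ℚ) [W'.IsElliptic] [W'.IsGloballyMinimal]
    (hiso : IsIsogenous W' (curve1323a1.quadraticTwist (d : ℚ)) ∨
      IsIsogenous W' (curve1323a1.quadraticTwist ((D * d : ℤ) : ℚ))) : BSDp W' 2 :=
  bsdp_two_of_isIsogenousToKrizLiTwistOfSmallCMBase hKL h33 hS31 hBF hmod hGZK hCassels W'
    (isIsogenousToKrizLiTwistOfSmallCMBase_of_curve1323a1_sqrtField hD4 hsf h3 h7 hSD hd hd0 hd12 h7d hiso)

/-- `d ∈ 𝒩(1323m1, K)` in any quadratic `K` with `d_K = D`, from explicit data phrased with `D`.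
[cite: KrizLi2019, Def. 4.1 (FMS) = arXiv Def. 3.1] -/
theorem inN_curve1323m1_of_discr_eq {K : Type} [Field K] [NumberField K] (h2 : Module.finrank ℚ K = 2)
    {D : ℤ} (hdK : NumberField.discr K = D) {d : ℤ} (hd4 : d % 4 = 1) (hsq : Squarefree d.natAbs)
    (hprimes : ∀ (ℓ : ℕ) (hℓ : ℓ.Prime), ℓ ∣ d.natAbs → haveI : NeZero ℓ := ⟨hℓ.ne_zero⟩;
      ℓ ≠ 2 ∧ ℓ ≠ 3 ∧ ℓ ≠ 7 ∧ jacobiSym D ℓ = 1 ∧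
      Even ((Finset.univ.filter fun x : ZMod ℓ => x ^ 3 = -(16 * (4 * (-2 : ZMod ℓ) + 1))).card)) :
    KrizLi2019.InN curve1323m1 K d := by
  subst hdK
  exact inN_curve1323m1_of_explicit h2 hd4 hsq hprimes

/-- **`1323m1` over `K = ℚ(√D)`, ANY certified `D`** (same shape as `1323a1`; certified at
`D ∈ {−47, −215, −479, −503, −551}`). [cite: KrizLi2019, Thm. 5.1 (2), Def. 4.1, §6 Ex. 6.2] [cite: Marcus2018, Ch. 2 Thm. 1] -/
theorem isIsogenousToKrizLiTwistOfSmallCMBase_of_curve1323m1_sqrtField {D : ℤ} [Fact (D < 0)]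
    (hD4 : D % 4 = 1) (hsf : Squarefree D.natAbs) (h3 : jacobiSym D 3 = 1) (h7 : jacobiSym D 7 = 1)
    (hSD : HasKrizLiStarDatum curve1323m1 (sqrtField D)) {d : ℤ}
    (hd : KrizLi2019.InN curve1323m1 (sqrtField D) d) (hd0 : 0 < d) (hd12 : d % 12 = 1) (h7d : ¬ (7 : ℤ) ∣ d)
    {W' : WeierstrassCurve ℚ}
    (hiso : IsIsogenous W' (curve1323m1.quadraticTwist (d : ℚ)) ∨
      IsIsogenous W' (curve1323m1.quadraticTwist ((D * d : ℤ) : ℚ))) :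
    IsIsogenousToKrizLiTwistOfSmallCMBase W' := by
  obtain ⟨hK, hdK⟩ := isImaginaryQuadratic_and_discr_sqrtField_of_squarefree_natAbs D hD4 hsf
  refine isIsogenousToKrizLiTwistOfSmallCMBase_of_curve1323m1 hK (by rw [hdK]; exact h3)
    (by rw [hdK]; exact h7) hSD hd hd0 hd12 h7d ?_
  rw [hdK, mul_comm]
  exact hiso

/-- **`BSD(W′, 2)` on the Kriz–Li family of `1323m1` over `ℚ(√D)`, any certified `D`.**
[cite: KrizLi2019, Thm. 5.1 (2) and Thm. 4.3] [cite: CreutzMiller2012, Thm. 1.1]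
[cite: BurungaleFlach2024, Thm. 1.1 and Cor. 2] [cite: MilneADT2006, Thm. I.7.3] -/
theorem bsdp_two_of_isIsogenous_twist_curve1323m1_sqrtField (hKL : KrizLi2019.thm112_bsdTwo_twist)
    (h33 : KrizLi2019.thm33_rank_twist) (hS31 : bsdTriple_of_analyticRank_le_one_of_conductor_lt)
    (hBF : bsdTriple_of_hasCM_of_L_one_ne_zero) (hmod : hasEntireLFunction_rat)
    (hGZK : rank_eq_analyticRank_of_analyticRank_le_one) (hCassels : bsdRHS_eq_of_isIsogenous)
    {D : ℤ} [Fact (D < 0)] (hD4 : D % 4 = 1) (hsf : Squarefree D.natAbs) (h3 : jacobiSym D 3 = 1)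
    (h7 : jacobiSym D 7 = 1) (hSD : HasKrizLiStarDatum curve1323m1 (sqrtField D)) {d : ℤ}
    (hd : KrizLi2019.InN curve1323m1 (sqrtField D) d) (hd0 : 0 < d) (hd12 : d % 12 = 1) (h7d : ¬ (7 : ℤ) ∣ d)
    (W' : WeierstrassCurve ℚ) [W'.IsElliptic] [W'.IsGloballyMinimal]
    (hiso : IsIsogenous W' (curve1323m1.quadraticTwist (d : ℚ)) ∨
      IsIsogenous W' (curve1323m1.quadraticTwist ((D * d : ℤ) : ℚ))) : BSDp W' 2 :=
  bsdp_two_of_isIsogenousToKrizLiTwistOfSmallCMBase hKL h33 hS31 hBF hmod hGZK hCassels W'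
    (isIsogenousToKrizLiTwistOfSmallCMBase_of_curve1323m1_sqrtField hD4 hsf h3 h7 hSD hd hd0 hd12 h7d hiso)

/-- `d ∈ 𝒩(4563a1, K)` in any quadratic `K` with `d_K = D`, from explicit data phrased with `D`.
[cite: KrizLi2019, Def. 4.1 (FMS) = arXiv Def. 3.1] -/
theorem inN_curve4563a1_of_discr_eq {K : Type} [Field K] [NumberField K] (h2 : Module.finrank ℚ K = 2)
    {D : ℤ} (hdK : NumberField.discr K = D) {d : ℤ} (hd4 : d % 4 = 1) (hsq : Squarefree d.natAbs)
    (hprimes : ∀ (ℓ : ℕ) (hℓ : ℓ.Prime), ℓ ∣ d.natAbs → haveI : NeZero ℓ := ⟨hℓ.ne_zero⟩;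
      ℓ ≠ 2 ∧ ℓ ≠ 3 ∧ ℓ ≠ 13 ∧ jacobiSym D ℓ = 1 ∧
      Even ((Finset.univ.filter fun x : ZMod ℓ => x ^ 3 = -(16 * (4 * (92823 : ZMod ℓ) + 1))).card)) :
    KrizLi2019.InN curve4563a1 K d := by
  subst hdK
  exact inN_curve4563a1_of_explicit h2 hd4 hsq hprimes

/-- **`4563a1` over `K = ℚ(√D)`, ANY certified `D`**: `(D/3) = (D/13) = 1`, `13 ∤ d` (certified at
`D ∈ {−23, −95, −191, −263, −287, −311, −407, −503, −599, −623}`, four of them composite).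
[cite: KrizLi2019, Thm. 5.1 (2), Def. 4.1, §6 Ex. 6.2] [cite: Marcus2018, Ch. 2 Thm. 1] -/
theorem isIsogenousToKrizLiTwistOfSmallCMBase_of_curve4563a1_sqrtField {D : ℤ} [Fact (D < 0)]
    (hD4 : D % 4 = 1) (hsf : Squarefree D.natAbs) (h3 : jacobiSym D 3 = 1) (h13 : jacobiSym D 13 = 1)
    (hSD : HasKrizLiStarDatum curve4563a1 (sqrtField D)) {d : ℤ}
    (hd : KrizLi2019.InN curve4563a1 (sqrtField D) d) (hd0 : 0 < d) (hd12 : d % 12 = 1)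
    (h13d : ¬ (13 : ℤ) ∣ d) {W' : WeierstrassCurve ℚ}
    (hiso : IsIsogenous W' (curve4563a1.quadraticTwist (d : ℚ)) ∨
      IsIsogenous W' (curve4563a1.quadraticTwist ((D * d : ℤ) : ℚ))) :
    IsIsogenousToKrizLiTwistOfSmallCMBase W' := by
  obtain ⟨hK, hdK⟩ := isImaginaryQuadratic_and_discr_sqrtField_of_squarefree_natAbs D hD4 hsf
  refine isIsogenousToKrizLiTwistOfSmallCMBase_of_curve4563a1 hK (by rw [hdK]; exact h3)
    (by rw [hdK]; exact h13) hSD hd hd0 hd12 h13d ?_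
  rw [hdK, mul_comm]
  exact hiso

/-- **`BSD(W′, 2)` on the Kriz–Li family of `4563a1` over `ℚ(√D)`, any certified `D`.**
[cite: KrizLi2019, Thm. 5.1 (2) and Thm. 4.3] [cite: CreutzMiller2012, Thm. 1.1]
[cite: BurungaleFlach2024, Thm. 1.1 and Cor. 2] [cite: MilneADT2006, Thm. I.7.3] -/
theorem bsdp_two_of_isIsogenous_twist_curve4563a1_sqrtField (hKL : KrizLi2019.thm112_bsdTwo_twist)
    (h33 : KrizLi2019.thm33_rank_twist) (hS31 : bsdTriple_of_analyticRank_le_one_of_conductor_lt)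
    (hBF : bsdTriple_of_hasCM_of_L_one_ne_zero) (hmod : hasEntireLFunction_rat)
    (hGZK : rank_eq_analyticRank_of_analyticRank_le_one) (hCassels : bsdRHS_eq_of_isIsogenous)
    {D : ℤ} [Fact (D < 0)] (hD4 : D % 4 = 1) (hsf : Squarefree D.natAbs) (h3 : jacobiSym D 3 = 1)
    (h13 : jacobiSym D 13 = 1) (hSD : HasKrizLiStarDatum curve4563a1 (sqrtField D)) {d : ℤ}
    (hd : KrizLi2019.InN curve4563a1 (sqrtField D) d) (hd0 : 0 < d) (hd12 : d % 12 = 1)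
    (h13d : ¬ (13 : ℤ) ∣ d) (W' : WeierstrassCurve ℚ) [W'.IsElliptic] [W'.IsGloballyMinimal]
    (hiso : IsIsogenous W' (curve4563a1.quadraticTwist (d : ℚ)) ∨
      IsIsogenous W' (curve4563a1.quadraticTwist ((D * d : ℤ) : ℚ))) : BSDp W' 2 :=
  bsdp_two_of_isIsogenousToKrizLiTwistOfSmallCMBase hKL h33 hS31 hBF hmod hGZK hCassels W'
    (isIsogenousToKrizLiTwistOfSmallCMBase_of_curve4563a1_sqrtField hD4 hsf h3 h13 hSD hd hd0 hd12 h13d hiso)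

/-! ## §2 p3's bases over `ℚ(√D)`: `243a1` (the PRINTED base) and `4563b1` (`x³ + y³ = 13`) -/

/-- **`243a1` over `K = ℚ(√D)`, ANY certified `D`** (`(D/3) = 1`; sixteen certified `D`, `−23` PRINTED): the
`K`-fibre (`IsIsogenousToKrizLiTwoFortyThreeTwistIn (sqrtField D) W′`, p3) lies in the generic family granted
the (★)-display. [cite: KrizLi2019, Thm. 5.1 (2), §6 Table 1 and Rem. 6.3] [cite: Marcus2018, Ch. 2 Thm. 1] -/
theorem isIsogenousToKrizLiTwistOfSmallCMBase_of_twoFortyThreeIn_sqrtField {D : ℤ} [Fact (D < 0)]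
    (hD4 : D % 4 = 1) (hsf : Squarefree D.natAbs) (h3 : jacobiSym D 3 = 1)
    (hSD : HasKrizLiStarDatum curve243a1 (sqrtField D)) {W' : WeierstrassCurve ℚ}
    (hW' : IsIsogenousToKrizLiTwoFortyThreeTwistIn (sqrtField D) W') :
    IsIsogenousToKrizLiTwistOfSmallCMBase W' := by
  obtain ⟨hK, hdK⟩ := isImaginaryQuadratic_and_discr_sqrtField_of_squarefree_natAbs D hD4 hsf
  exact isIsogenousToKrizLiTwistOfSmallCMBase_of_twoFortyThreeIn (sqrtField D) hK (by rw [hdK]; exact h3)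
    hSD hW'

/-- **`BSD(W′, 2)` on the Kriz–Li family of `243a1` over `ℚ(√D)`, any certified `D`**: `d ∈ 𝒩(243a1, ℚ(√D))`
(e.g. by p3's `inN_curve243a1_of_discr` with `d_K = D`), `χ_d(−N) = 1`.
[cite: KrizLi2019, Thm. 5.1 (2) and Thm. 4.3] [cite: CreutzMiller2012, Thm. 1.1]
[cite: BurungaleFlach2024, Thm. 1.1 and Cor. 2] [cite: MilneADT2006, Thm. I.7.3] -/
theorem bsdp_two_of_isIsogenous_twist_curve243a1_sqrtField (hKL : KrizLi2019.thm112_bsdTwo_twist)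
    (h33 : KrizLi2019.thm33_rank_twist) (hS31 : bsdTriple_of_analyticRank_le_one_of_conductor_lt)
    (hBF : bsdTriple_of_hasCM_of_L_one_ne_zero) (hmod : hasEntireLFunction_rat)
    (hGZK : rank_eq_analyticRank_of_analyticRank_le_one) (hCassels : bsdRHS_eq_of_isIsogenous)
    {D : ℤ} [Fact (D < 0)] (hD4 : D % 4 = 1) (hsf : Squarefree D.natAbs) (h3 : jacobiSym D 3 = 1)
    (hSD : HasKrizLiStarDatum curve243a1 (sqrtField D)) {d : ℤ}
    (hd : KrizLi2019.InN curve243a1 (sqrtField D) d)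
    (hsign : Int.sign d * jacobiSym (curve243a1.conductorNorm ℤ) d.natAbs = 1)
    (W' : WeierstrassCurve ℚ) [W'.IsElliptic] [W'.IsGloballyMinimal]
    (hiso : IsIsogenous W' (curve243a1.quadraticTwist (d : ℚ)) ∨
      IsIsogenous W' (curve243a1.quadraticTwist ((D * d : ℤ) : ℚ))) : BSDp W' 2 := by
  obtain ⟨hK, hdK⟩ := isImaginaryQuadratic_and_discr_sqrtField_of_squarefree_natAbs D hD4 hsf
  refine bsdp_two_of_isIsogenous_twist_curve243a1_of_field hKL h33 hS31 hBF hmod hGZK hCassels (sqrtField D) hK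
    (by rw [hdK]; exact h3) hSD hd hsign W' ?_
  rw [hdK, mul_comm]
  exact hiso

/-- `d ∈ 𝒩(4563b1, K)` in any quadratic `K` with `d_K = D`, from explicit data phrased with `D`: every prime
`ℓ ∣ d` has `ℓ ∉ {2, 3, 13}`, `(D/ℓ) = 1` and an even number of roots of `x³ = −2704` in `𝔽_ℓ` (p3's
`odd_frobeniusTrace_curve4563b1_iff`; `IsKrizLiPrime4563` is the case `D = −23`).
[cite: KrizLi2019, Def. 4.1 (FMS) = arXiv Def. 3.1] -/
theorem inN_curve4563b1_of_discr_eq {K : Type} [Field K] [NumberField K] (h2 : Module.finrank ℚ K = 2)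
    {D : ℤ} (hdK : NumberField.discr K = D) {d : ℤ} (hd4 : d % 4 = 1) (hsq : Squarefree d.natAbs)
    (hprimes : ∀ (ℓ : ℕ) (hℓ : ℓ.Prime), ℓ ∣ d.natAbs → haveI : NeZero ℓ := ⟨hℓ.ne_zero⟩;
      ℓ ≠ 2 ∧ ℓ ≠ 3 ∧ ℓ ≠ 13 ∧ jacobiSym D ℓ = 1 ∧
      Even ((Finset.univ.filter fun x : ZMod ℓ => x ^ 3 = -2704).card)) :
    KrizLi2019.InN curve4563b1 K d := by
  subst hdK
  refine inN_of_explicit (S := fun ℓ => ∃ hℓ : ℓ.Prime, haveI : NeZero ℓ := ⟨hℓ.ne_zero⟩;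
      ℓ ≠ 2 ∧ ℓ ≠ 3 ∧ ℓ ≠ 13 ∧ jacobiSym (NumberField.discr K) ℓ = 1 ∧
      Even ((Finset.univ.filter fun x : ZMod ℓ => x ^ 3 = -2704).card))
    (fun ℓ ⟨hℓ, h⟩ => ?_) hd4 hsq (fun ℓ hℓ hℓd => ⟨hℓ, hprimes ℓ hℓ hℓd⟩)
  haveI : NeZero ℓ := ⟨hℓ.ne_zero⟩
  obtain ⟨hℓ2, hℓ3, hℓ13, hj, hev⟩ := h
  exact inS_of_explicit h2 hℓ hℓ2 (not_dvd_two_mul_conductorNorm_curve4563b1 hℓ hℓ2 hℓ3 hℓ13) hj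
    ((odd_frobeniusTrace_curve4563b1_iff hℓ hℓ2 hℓ3 hℓ13).mpr hev)

/-- **`4563b1` over `K = ℚ(√D)`, ANY certified `D`** (`(D/3) = (D/13) = 1`; ten certified `D`, four composite):
membership in the generic family granted the (★)-display, for `d ∈ 𝒩`, `d > 0`, `d ≡ 1 (mod 12)`, `(d/13) = 1`.
[cite: KrizLi2019, Thm. 5.1 (2), Def. 4.1, §6 Ex. 6.2] [cite: Marcus2018, Ch. 2 Thm. 1] -/
theorem isIsogenousToKrizLiTwistOfSmallCMBase_of_curve4563b1_sqrtField {D : ℤ} [Fact (D < 0)]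
    (hD4 : D % 4 = 1) (hsf : Squarefree D.natAbs) (h3 : jacobiSym D 3 = 1) (h13 : jacobiSym D 13 = 1)
    (hSD : HasKrizLiStarDatum curve4563b1 (sqrtField D)) {d : ℤ}
    (hd : KrizLi2019.InN curve4563b1 (sqrtField D) d) (hd0 : 0 < d) (hd12 : d % 12 = 1)
    (hd13 : jacobiSym d 13 = 1) {W' : WeierstrassCurve ℚ}
    (hiso : IsIsogenous W' (curve4563b1.quadraticTwist (d : ℚ)) ∨
      IsIsogenous W' (curve4563b1.quadraticTwist ((D * d : ℤ) : ℚ))) :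
    IsIsogenousToKrizLiTwistOfSmallCMBase W' := by
  haveI : Fact (2 : ℕ).Prime := ⟨Nat.prime_two⟩
  obtain ⟨hK, hdK⟩ := isImaginaryQuadratic_and_discr_sqrtField_of_squarefree_natAbs D hD4 hsf
  have hiso' : IsIsogenous W' (curve4563b1.quadraticTwist (d : ℚ)) ∨
      IsIsogenous W' (curve4563b1.quadraticTwist ((d * NumberField.discr (sqrtField D) : ℤ) : ℚ)) := by
    rw [hdK, mul_comm]
    exact hiso
  exact ⟨curve4563b1, inferInstance, inferInstance, inferInstance, hasCM_curve4563b1, conductorNorm_curve4563b1_lt,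
    one_le_mordellWeilRank_curve4563b1, twoTorsion_curve4563b1, odd_localTamagawaNumber_two_curve4563b1,
    sqrtField D, inferInstance, inferInstance, hK,
    satisfiesHeegnerHypothesis_curve4563b1_of_jacobiSym hK.1 (by rw [hdK]; exact h3) (by rw [hdK]; exact h13),
    hSD, d, hd, sign_mul_jacobiSym_conductorNorm_curve4563b1 hd0 hd12 hd13, hiso'⟩

/-- **`BSD(W′, 2)` on the Kriz–Li family of `4563b1` over `ℚ(√D)`, any certified `D`.**
[cite: KrizLi2019, Thm. 5.1 (2) and Thm. 4.3] [cite: CreutzMiller2012, Thm. 1.1]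
[cite: BurungaleFlach2024, Thm. 1.1 and Cor. 2] [cite: MilneADT2006, Thm. I.7.3] -/
theorem bsdp_two_of_isIsogenous_twist_curve4563b1_sqrtField (hKL : KrizLi2019.thm112_bsdTwo_twist)
    (h33 : KrizLi2019.thm33_rank_twist) (hS31 : bsdTriple_of_analyticRank_le_one_of_conductor_lt)
    (hBF : bsdTriple_of_hasCM_of_L_one_ne_zero) (hmod : hasEntireLFunction_rat)
    (hGZK : rank_eq_analyticRank_of_analyticRank_le_one) (hCassels : bsdRHS_eq_of_isIsogenous)
    {D : ℤ} [Fact (D < 0)] (hD4 : D % 4 = 1) (hsf : Squarefree D.natAbs) (h3 : jacobiSym D 3 = 1)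
    (h13 : jacobiSym D 13 = 1) (hSD : HasKrizLiStarDatum curve4563b1 (sqrtField D)) {d : ℤ}
    (hd : KrizLi2019.InN curve4563b1 (sqrtField D) d) (hd0 : 0 < d) (hd12 : d % 12 = 1)
    (hd13 : jacobiSym d 13 = 1) (W' : WeierstrassCurve ℚ) [W'.IsElliptic] [W'.IsGloballyMinimal]
    (hiso : IsIsogenous W' (curve4563b1.quadraticTwist (d : ℚ)) ∨
      IsIsogenous W' (curve4563b1.quadraticTwist ((D * d : ℤ) : ℚ))) : BSDp W' 2 :=
  bsdp_two_of_isIsogenousToKrizLiTwistOfSmallCMBase hKL h33 hS31 hBF hmod hGZK hCassels W'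
    (isIsogenousToKrizLiTwistOfSmallCMBase_of_curve4563b1_sqrtField hD4 hsf h3 h13 hSD hd hd0 hd12 hd13 hiso)

/-! ## §3 E-GENERIC over `ℚ(√D)`: any (★)-base, any certified `D` (entry point for further certified bases) -/

section Generic

variable (W : WeierstrassCurve ℚ) [W.IsElliptic] [W.IsGloballyMinimal] [NeZero (W.conductorNorm ℤ)]

/-- **`ord_{s=1} L(W, s) = 1` for a (★)-base over `K = ℚ(√D)`**, `D < 0`, `D ≡ 1 (mod 8)`, `|D|` square-free,
`(D/ℓ) = 1` at the odd primes `ℓ ∣ N(W)`: a CM base with a rational point of infinite order and `E(ℚ)[2] = 0`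
carrying a displayed (★)-datum over `sqrtField D` (E-generic form of the per-base statements; p3's
`analyticRank_eq_one_of_hasKrizLiStarDatum` with the field binders discharged from `D`).
[cite: KrizLi2019, Thm. 4.3 (FMS)] [cite: BurungaleFlach2024, Cor. 2] [cite: Marcus2018, Ch. 2 Thm. 1, Ch. 3 Thm. 25] -/
theorem analyticRank_eq_one_of_hasKrizLiStarDatum_sqrtField (h33 : KrizLi2019.thm33_rank_twist)
    (hBF : bsdTriple_of_hasCM_of_L_one_ne_zero) (hmod : hasEntireLFunction_rat)
    (hcm : W.HasCM) (hrk : 1 ≤ W.mordellWeilRank) (h2 : ∀ Q : W.toAffine.Point, 2 • Q = 0 → Q = 0)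
    {D : ℤ} [Fact (D < 0)] (hD8 : D % 8 = 1) (hsf : Squarefree D.natAbs)
    (hH : ∀ ℓ : ℕ, ℓ.Prime → ℓ ∣ W.conductorNorm ℤ → ℓ ≠ 2 → jacobiSym D ℓ = 1)
    (hSD : HasKrizLiStarDatum W (sqrtField D)) : W.analyticRank = 1 :=
  analyticRank_eq_one_of_hasKrizLiStarDatum W h33 hBF hmod hcm hrk h2 (sqrtField D)
    (isImaginaryQuadratic_sqrtField D)
    (satisfiesHeegnerHypothesis_sqrtField_of_squarefree_natAbs D hD8 hsf
      fun ℓ hℓ hℓN => (em (ℓ = 2)).imp_right (hH ℓ hℓ hℓN)) hSD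

/-- **E-GENERIC MEMBERSHIP over `K = ℚ(√D)`**: a globally minimal CM base `W` with `N(W) < 5000`, a rational point of
infinite order, `E(ℚ)[2] = 0`, `c₂(W)` odd; a certified `D` (`D < 0`, `D ≡ 1 (mod 8)`, `|D|` square-free,
`(D/ℓ) = 1` at the odd `ℓ ∣ N(W)`) with a displayed (★)-datum over `sqrtField D`; `d ∈ 𝒩(W, ℚ(√D))` with
`χ_d(−N) = 1` ⟹ every `W′ ~ W^{(d)}` or `W^{(D·d)}` lies in the generic family of aside 21366. The one-call entry
point for any FURTHER certified (★)-base. [cite: KrizLi2019, Thm. 5.1 (2), Def. 4.1, §6 Ex. 6.2]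
[cite: Marcus2018, Ch. 2 Thm. 1, Ch. 3 Thm. 25] -/
theorem isIsogenousToKrizLiTwistOfSmallCMBase_of_hasKrizLiStarDatum_sqrtField (hcm : W.HasCM)
    (hN : W.conductorNorm ℤ < 5000) (hrk : 1 ≤ W.mordellWeilRank) (h2 : ∀ Q : W.toAffine.Point, 2 • Q = 0 → Q = 0)
    (hc2 : haveI : Fact (2 : ℕ).Prime := ⟨Nat.prime_two⟩; Odd ((W.baseChange ℚ_[2]).localTamagawaNumber ℤ_[2]))
    {D : ℤ} [Fact (D < 0)] (hD8 : D % 8 = 1) (hsf : Squarefree D.natAbs)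
    (hH : ∀ ℓ : ℕ, ℓ.Prime → ℓ ∣ W.conductorNorm ℤ → ℓ ≠ 2 → jacobiSym D ℓ = 1)
    (hSD : HasKrizLiStarDatum W (sqrtField D)) {d : ℤ} (hd : KrizLi2019.InN W (sqrtField D) d)
    (hsign : Int.sign d * jacobiSym (W.conductorNorm ℤ) d.natAbs = 1) {W' : WeierstrassCurve ℚ}
    (hiso : IsIsogenous W' (W.quadraticTwist (d : ℚ)) ∨ IsIsogenous W' (W.quadraticTwist ((D * d : ℤ) : ℚ))) :
    IsIsogenousToKrizLiTwistOfSmallCMBase W' := by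
  obtain ⟨hK, hdK⟩ := isImaginaryQuadratic_and_discr_sqrtField_of_squarefree_natAbs D (by omega) hsf
  have hiso' : IsIsogenous W' (W.quadraticTwist (d : ℚ)) ∨
      IsIsogenous W' (W.quadraticTwist ((d * NumberField.discr (sqrtField D) : ℤ) : ℚ)) := by
    rw [hdK, mul_comm]
    exact hiso
  exact ⟨W, inferInstance, inferInstance, inferInstance, hcm, hN, hrk, h2, hc2, sqrtField D, inferInstance,
    inferInstance, hK,
    satisfiesHeegnerHypothesis_sqrtField_of_squarefree_natAbs D hD8 hsf
      (fun ℓ hℓ hℓN => (em (ℓ = 2)).imp_right (hH ℓ hℓ hℓN)),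
    hSD, d, hd, hsign, hiso'⟩

/-- **E-GENERIC `BSD(W′, 2)` over `K = ℚ(√D)`** (same hypotheses), granted BY NAME the seven facts of aside 21366
and the displayed (★)-datum. [cite: KrizLi2019, Thm. 5.1 (2) and Thm. 4.3] [cite: CreutzMiller2012, Thm. 1.1]
[cite: BurungaleFlach2024, Thm. 1.1 and Cor. 2] [cite: MilneADT2006, Thm. I.7.3] -/
theorem bsdp_two_of_isIsogenous_twist_of_hasKrizLiStarDatum_sqrtField (hKL : KrizLi2019.thm112_bsdTwo_twist)
    (h33 : KrizLi2019.thm33_rank_twist) (hS31 : bsdTriple_of_analyticRank_le_one_of_conductor_lt)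
    (hBF : bsdTriple_of_hasCM_of_L_one_ne_zero) (hmod : hasEntireLFunction_rat)
    (hGZK : rank_eq_analyticRank_of_analyticRank_le_one) (hCassels : bsdRHS_eq_of_isIsogenous)
    (hcm : W.HasCM) (hN : W.conductorNorm ℤ < 5000) (hrk : 1 ≤ W.mordellWeilRank)
    (h2 : ∀ Q : W.toAffine.Point, 2 • Q = 0 → Q = 0)
    (hc2 : haveI : Fact (2 : ℕ).Prime := ⟨Nat.prime_two⟩; Odd ((W.baseChange ℚ_[2]).localTamagawaNumber ℤ_[2]))
    {D : ℤ} [Fact (D < 0)] (hD8 : D % 8 = 1) (hsf : Squarefree D.natAbs)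
    (hH : ∀ ℓ : ℕ, ℓ.Prime → ℓ ∣ W.conductorNorm ℤ → ℓ ≠ 2 → jacobiSym D ℓ = 1)
    (hSD : HasKrizLiStarDatum W (sqrtField D)) {d : ℤ} (hd : KrizLi2019.InN W (sqrtField D) d)
    (hsign : Int.sign d * jacobiSym (W.conductorNorm ℤ) d.natAbs = 1)
    (W' : WeierstrassCurve ℚ) [W'.IsElliptic] [W'.IsGloballyMinimal]
    (hiso : IsIsogenous W' (W.quadraticTwist (d : ℚ)) ∨ IsIsogenous W' (W.quadraticTwist ((D * d : ℤ) : ℚ))) :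
    BSDp W' 2 :=
  bsdp_two_of_isIsogenousToKrizLiTwistOfSmallCMBase hKL h33 hS31 hBF hmod hGZK hCassels W'
    (isIsogenousToKrizLiTwistOfSmallCMBase_of_hasKrizLiStarDatum_sqrtField W hcm hN hrk h2 hc2 hD8 hsf hH hSD hd
      hsign hiso)

end Generic


end Summit.BirchSwinnertonDyer.Rank1Residual.P2

end
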